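import Mathlib
import HarnessLib
import Summits.NavierStokesRegularity.NavierStokesRegularity.Theorems.HalfSpaceWindowDoorCirculationCarryingRigidityTiltDominatedLiouville

/-!
# Route `HalfSpaceWindowDoor`, crux `CirculationCarryingRigidity` (stmt-NavierStokesRegularity-25311) — census corollary:
# LRT's POINTWISE single cone in the space–time Type-I subclass is trivial

The pointwise single cone `‖ω_h‖ ≤ K ω₃` (Lei–Ren–Tian's double cone `|ω| ≤ C|ω₃|` intersected with the closed hemisphere
`ω₃ ≥ 0`) implies AxisTwistDoor's circle-averaged cone `GlobalCone` (`globalCone_of_pointwise`), so the census theorem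
`…TiltDominatedLiouville.eq_zero_of_hasTypeIDecay_signE3_globalCone` gives: a closed-hemisphere door-class profile of the
space–time Type-I subclass whose vorticity lies pointwise in a single cone about `e₃` vanishes identically
(`eq_zero_of_hasTypeIDecay_pointwiseCone`).  Census row for crux 25311: stratum {space–time Type I} ∩ {single cone} DEAD
(the time-only class version is not covered: no disc-circulation bound there).

Seat ns-hsw-p1 g3 (LEAD of 25311, cell pub-ns-dss).  WHAT THIS IS NOT: not a statement about Navier–Stokes regularity;
HYPOTHETICAL blow-up profiles; helper `--supports` 25311.
-/

noncomputable section

-- the summit and its single sub-problem share the name (CONVENTIONS §1), as in every Theorems file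
set_option linter.dupNamespace false

namespace Summit.NavierStokesRegularity.NavierStokesRegularity.Theorems.HalfSpaceWindowDoorCirculationCarryingRigidityPointwiseConeLiouville

open MeasureTheory Set Function Filter Topology TopologicalSpace InnerProductSpace WithLp Metric
open scoped RealInnerProductSpace ContDiff
open Literature.Analysis Literature.Analysis.FluidPDE
open Summit.NavierStokesRegularity.NavierStokesRegularity.Theorems.AxisTwistDoorAveragedConeLiouvilleDefs
  (cylPt e3 vortCirc tiltCirc GlobalCone)
open Summit.NavierStokesRegularity.NavierStokesRegularity.Theorems.HalfSpaceWindowDoorCirculationCarryingRigidityAxisCirculation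
  (isSmoothSpaceTimeOn_of_class)
open Summit.NavierStokesRegularity.NavierStokesRegularity.Theorems.HalfSpaceWindowDoorCirculationCarryingRigidityTiltDominatedLiouville
  (eq_zero_of_hasTypeIDecay_signE3_globalCone)

/-! ### The pointwise (Lei–Ren–Tian) single cone -/

/-- A POINTWISE single cone `‖ω_h‖ ≤ K ω₃` (LRT's double cone `|ω| ≤ C|ω₃|` intersected with the closed hemisphere) implies the
circle-averaged cone `GlobalCone`. -/
theorem globalCone_of_pointwise {K : ℝ} (hK : 0 ≤ K)
    {v : ℝ → EuclideanSpace ℝ (Fin 3) → EuclideanSpace ℝ (Fin 3)}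
    (hC1 : ∀ s < 0, ContDiff ℝ 1 (v s))
    (hpt : ∀ s < 0, ∀ y : EuclideanSpace ℝ (Fin 3),
      ‖curl (v s) y - ⟪curl (v s) y, (EuclideanSpace.single (2 : Fin 3) (1 : ℝ))⟫_ℝ •
          (EuclideanSpace.single (2 : Fin 3) (1 : ℝ))‖ ≤
        K * ⟪curl (v s) y, (EuclideanSpace.single (2 : Fin 3) (1 : ℝ))⟫_ℝ) :
    GlobalCone v := by
  have htilt : ∀ s < 0, ∀ r : ℝ, 0 < r → ∀ z : ℝ, tiltCirc v r z s ≤ K * vortCirc v r z s := by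
    intro s hs r hr z
    have hωc : Continuous fun θ => curl (v s) (cylPt r θ z) := by
      have hD : Continuous (fderiv ℝ (v s)) := (hC1 s hs).continuous_fderiv one_ne_zero
      have e : curl (v s) = fun x => curlCLM (fderiv ℝ (v s) x) := by funext x; exact curl_eq_curlCLM (v s) x
      rw [e]
      exact (curlCLM.continuous.comp hD).comp
        (Summit.NavierStokesRegularity.NavierStokesRegularity.Theorems.AxisTwistDoorAveragedConeLiouvilleCylFrame.continuous_cylPt_θ
          r z)
    have h2π : (0 : ℝ) ≤ 2 * Real.pi := by positivity
    have hf : Continuous fun θ => ‖curl (v s) (cylPt r θ z) - ⟪curl (v s) (cylPt r θ z), e3⟫_ℝ • e3‖ * r :=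
      ((Summit.NavierStokesRegularity.NavierStokesRegularity.Theorems.AxisTwistDoorAveragedConeLiouvilleCylFrame.continuous_horizontal.comp
        hωc).norm).mul continuous_const
    have hg : Continuous fun θ => K * (⟪curl (v s) (cylPt r θ z), e3⟫_ℝ * r) :=
      continuous_const.mul ((hωc.inner continuous_const).mul continuous_const)
    have hle : ∀ θ ∈ Icc (0 : ℝ) (2 * Real.pi),
        ‖curl (v s) (cylPt r θ z) - ⟪curl (v s) (cylPt r θ z), e3⟫_ℝ • e3‖ * r ≤
          K * (⟪curl (v s) (cylPt r θ z), e3⟫_ℝ * r) := by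
      intro θ _
      have h := hpt s hs (cylPt r θ z)
      rw [← Summit.NavierStokesRegularity.NavierStokesRegularity.Theorems.AxisTwistDoorAveragedConeLiouvilleCylFrame.e3_eq] at h
      nlinarith [h, hr.le]
    have hmono := intervalIntegral.integral_mono_on (μ := volume) h2π (hf.intervalIntegrable _ _) (hg.intervalIntegrable _ _) hle
    rw [intervalIntegral.integral_const_mul] at hmono
    exact hmono
  exact ⟨K, hK, htilt⟩

/-- **Census corollary (LRT's pointwise single cone).** A closed-hemisphere door-class profile of the space–time Type-I subclass
whose vorticity lies POINTWISE in a single cone about `e₃`, `‖ω_h‖ ≤ K ω₃`, vanishes identically. -/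
theorem eq_zero_of_hasTypeIDecay_pointwiseCone (C D K : ℝ) (hK : 0 ≤ K)
    (v : ℝ → EuclideanSpace ℝ (Fin 3) → EuclideanSpace ℝ (Fin 3))
    (hrate : HasTypeITimeDecay C v)
    (hcont : ContinuousOn (uncurry v) (Iio (0 : ℝ) ×ˢ univ))
    (hmild : ∀ s t : ℝ, s < t → t < 0 → ∀ x,
      v t x = UnboundedOperators.heatExtension (v s) (t - s) x - oseenDuhamel 1 s v v t x)
    (hdiv : ∀ t < 0, VectorCalculus.IsDivFree (v t)) (hD : HasTypeIDecay D v)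
    (hsign : ∀ s < 0, ∀ y, 0 ≤ ⟪curl (v s) y, (EuclideanSpace.single (2 : Fin 3) (1 : ℝ))⟫_ℝ)
    (hpt : ∀ s < 0, ∀ y : EuclideanSpace ℝ (Fin 3),
      ‖curl (v s) y - ⟪curl (v s) y, (EuclideanSpace.single (2 : Fin 3) (1 : ℝ))⟫_ℝ •
          (EuclideanSpace.single (2 : Fin 3) (1 : ℝ))‖ ≤
        K * ⟪curl (v s) y, (EuclideanSpace.single (2 : Fin 3) (1 : ℝ))⟫_ℝ) :
    ∀ t < 0, ∀ x, v t x = 0 := by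
  have hsm : IsSmoothSpaceTimeOn (Iio (0 : ℝ)) v := isSmoothSpaceTimeOn_of_class hrate hcont hmild hdiv
  have hC1 : ∀ s < 0, ContDiff ℝ 1 (v s) := fun s hs => (hsm.contDiff_slice hs).of_le (by norm_cast)
  exact eq_zero_of_hasTypeIDecay_signE3_globalCone C D v hrate hcont hmild hdiv hD hsign
    (globalCone_of_pointwise hK hC1 hpt)

end Summit.NavierStokesRegularity.NavierStokesRegularity.Theorems.HalfSpaceWindowDoorCirculationCarryingRigidityPointwiseConeLiouville

end
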